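import Summits.QuantumFields.BalabanUV.T4Continuum.Support.NE7LyapunovMainPartComposites
import Summits.QuantumFields.BalabanUV.T4Continuum.Support.NE7WhitneyLiftFlat
import Literature.MathematicalPhysics.QuantumFieldTheory.Balaban1983to89.MatrixNorms
import HarnessLib

/-!
# NE7LiftMainPartMatrix — THE MAIN PART `W∘B_c⁻¹` OF THE EXACT LIFT ON MATRIX-VALUED 1-FORMS (operator-norm currency `dirSq`): ENTRY BY ENTRY it is the scalar iterate
# ✓ `mainIter`, hence **`dirSq ((W∘B_c⁻¹)^{(m)} w) [0,2^mN)⁴ ≤ card n · 12⁴ · 7.2^m · dirSq w [0,N)⁴`** (`d = 4`, `L = 2`, every `U(n)`-size `n`, uniform in `m`, `N`)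
# (lineage `b2b-balaban-t4-ne7b-p1`, gen 163; route (H′), memo `t4/b2b-balaban-t4-ne7b-p1/g162/records/SCOPING-LEVELMASSES.md` §11 «CURRENCY» + §12 (R3c))

Cell `pub-balaban`, rung (B)+1 sub-cell t4, lineage `b2b-balaban-t4-ne7b-p1` (row NE7b OWNER + CRUX PROVER; junction service for row NE7 on ROAD-G116 §6 (G3) ∕ the ℓ² route to (G′)),
generation 163.
WHY.  ✓ `NE7LyapunovMainPartComposites.sum_norm_sq_mainIter_le` bounds the composites of one component of `W∘B_c⁻¹` for fields with values in any real INNER PRODUCT space (the SOS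
certificates need inner products).  The tree's 1-forms are `Matrix n n ℂ`-valued with the OPERATOR norm (✓ `dirSq`), which is not a Hilbert norm.  The lift is a real-linear combination of
point values, so it acts ENTRY BY ENTRY; each entry is a `ℂ`-valued field (`ℂ` is a real inner product space), and `‖X‖_op² ≤ Σ_ij |X_ij|² ≤ card n·‖X‖_op²` (✓ `MatrixNorms`).  THIS FILE
carries the bound over, at the price of one factor `card n` (level-independent).
WHAT ([folklore]; DATA defs `Tmat`, `TmatIter`; 0 sorry; every `d` in §1, `d = 4`, `M = 2` in §2–§3):
§1 entries commute with the lift's constituents: `interpCore_entry`, `interp_entry`, `stencilInv1_entry`, `stencilInvList_entry`, `stencilInv_entry`; the two norm comparisons summed over a box: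
   `dirSq_le_sum_entries`, `sum_entries_le_card_mul_dirSq`;
§2 `Tmat N w z κ := ½ • interp 2 (univ∖{κ}) (stencilInv N ¼ (w·κ)) z` (the main part of ✓ `NE7WhitneyExactLiftFlat`'s lift at `M = 2`, `c = ¼`), `TmatIter N m` (periods `N → 2^m N`),
   **`TmatIter_entry`** (`(TmatIter N m w z κ) i j = mainIter N κ m (x ↦ w x κ i j) z`), `Tmat_periodic`, `TmatIter_periodic`;
§3 **`dirSq_TmatIter_le`**: for `N ≥ 1` and an `N`-periodic `w`, `dirSq (TmatIter N m w) (periodBox (2^m N)) ≤ card n · 12⁴ · (3(17∕8)³∕4)^m · dirSq w (periodBox N)`.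
WHAT IS NOT HERE: the gauge part of the exact lift and the assembly of (C) — next file.
HONEST FRAMING (page 1): elementary bookkeeping about OUR lift; nothing of Bałaban's asserted; NOT (C), NOT (G3), NOT (G′), NOT NE7∕NE3 as spine nodes; row NE7b NOT PRINTED ∕ NOT PROVED; spine 0∕9;
finite T⁴ rung (B)+1 — NOT infinite volume, NOT mass gap, NOT BetaPertH, NOT Clay.
-/

set_option autoImplicit false

open scoped BigOperators Matrix Matrix.Norms.L2Operator
open Finset

namespace Summit.QuantumFields.BalabanUV.T4Continuum.NE7LiftMainPartMatrix

open Literature.MathematicalPhysics.QuantumFieldTheory.Balaban1983to89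
open B7Prop1Explicit
open T4AveragingDeficitWall (dirSq)
open T4AveragingDeficitWallBoundary (periodBox)
open SmoothRefineInterp (interp interpCore)
open NE3CoarseInterpolant (interp_add_period)
open NE7StencilInverse (stencilInv1 stencilInvList stencilInv stencilInv_periodic)
open NE7LyapunovMainPartComposites (mainC mainIter sum_norm_sq_mainIter_le)
open MatrixNorms (opNorm_sq_le_sum_norm_sq sum_norm_sq_col_le_opNorm_sq)

noncomputable section

variable {d : ℕ} {n : Type*} [Fintype n] [DecidableEq n]

/-! ## §1 Entries commute with the constituents of the lift; the two norms summed over a box -/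

omit [Fintype n] [DecidableEq n] in
/-- Entries of the interpolation core. [folklore] -/
theorem interpCore_entry (S : Finset (Fin d)) (G : Site d → Matrix n n ℂ) (z : Site d) (w : Fin d → ℝ) (i j : n) :
    interpCore S G z w i j = interpCore S (fun x => G x i j) z w := by
  unfold interpCore
  simp only [Matrix.sum_apply, Matrix.smul_apply]

omit [Fintype n] [DecidableEq n] in
/-- Entries of the interpolant. [folklore] -/
theorem interp_entry (M : ℕ) (S : Finset (Fin d)) (G : Site d → Matrix n n ℂ) (y : Site d) (i j : n) :
    interp M S G y i j = interp M S (fun x => G x i j) y :=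
  interpCore_entry S G _ _ i j

omit [Fintype n] [DecidableEq n] in
/-- Entries of the one-direction stencil inverse. [folklore] -/
theorem stencilInv1_entry (k : Fin d) (N : ℕ) (a b : ℝ) (G : Site d → Matrix n n ℂ) (y : Site d) (i j : n) :
    stencilInv1 k N a b G y i j = stencilInv1 k N a b (fun x => G x i j) y := by
  simp only [stencilInv1, Matrix.smul_apply, Matrix.sum_apply]

omit [Fintype n] [DecidableEq n] in
/-- Entries of the iterated stencil inverse. [folklore] -/
theorem stencilInvList_entry (l : List (Fin d)) (N : ℕ) (a b : ℝ) : ∀ (G : Site d → Matrix n n ℂ) (y : Site d) (i j : n),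
    stencilInvList l N a b G y i j = stencilInvList l N a b (fun x => G x i j) y := by
  induction l with
  | nil => intro G y i j; rfl
  | cons k l ih =>
      intro G y i j
      rw [NE7StencilInverse.stencilInvList_cons, NE7StencilInverse.stencilInvList_cons, stencilInv1_entry]
      congr 1
      funext x
      exact ih G x i j

omit [Fintype n] [DecidableEq n] in
/-- Entries of `stencilInv`. [folklore] -/
theorem stencilInv_entry (N : ℕ) (c : ℝ) (G : Site d → Matrix n n ℂ) (y : Site d) (i j : n) :
    stencilInv N c G y i j = stencilInv N c (fun x => G x i j) y :=
  stencilInvList_entry _ N _ _ G y i j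

/-- **OPERATOR MASS ≤ ENTRY MASS**: `dirSq ψ F ≤ Σ_{x∈F} Σ_κ Σ_i Σ_j |ψ x κ i j|²`. [folklore] -/
theorem dirSq_le_sum_entries (ψ : Site d → Fin d → Matrix n n ℂ) (F : Finset (Site d)) :
    dirSq ψ F ≤ ∑ x ∈ F, ∑ κ : Fin d, ∑ i, ∑ j, ‖ψ x κ i j‖ ^ 2 := by
  unfold dirSq
  exact Finset.sum_le_sum fun x _ => Finset.sum_le_sum fun κ _ => opNorm_sq_le_sum_norm_sq (ψ x κ)

/-- **ENTRY MASS ≤ `card n` × OPERATOR MASS**: `Σ_{x∈F} Σ_κ Σ_i Σ_j |ψ x κ i j|² ≤ card n · dirSq ψ F`. [folklore] -/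
theorem sum_entries_le_card_mul_dirSq (ψ : Site d → Fin d → Matrix n n ℂ) (F : Finset (Site d)) :
    ∑ x ∈ F, ∑ κ : Fin d, ∑ i, ∑ j, ‖ψ x κ i j‖ ^ 2 ≤ (Fintype.card n : ℝ) * dirSq ψ F := by
  unfold dirSq
  rw [Finset.mul_sum]
  refine Finset.sum_le_sum fun x _ => ?_
  rw [Finset.mul_sum]
  refine Finset.sum_le_sum fun κ _ => ?_
  rw [Finset.sum_comm]
  calc ∑ j, ∑ i, ‖ψ x κ i j‖ ^ 2 ≤ ∑ _j : n, ‖ψ x κ‖ ^ 2 := Finset.sum_le_sum fun j _ => sum_norm_sq_col_le_opNorm_sq (ψ x κ) j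
    _ = (Fintype.card n : ℝ) * ‖ψ x κ‖ ^ 2 := by rw [Finset.sum_const, Finset.card_univ, nsmul_eq_mul]

/-! ## §2 The main part of the lift on matrix 1-forms (`d = 4`, `M = 2`, `c = ¼`) and its iterate -/

/-- **THE MAIN PART `W∘B_{¼}⁻¹`** of the exact lift of record at `M = 2`, from period `N` to period `2N`. [folklore] -/
def Tmat (N : ℕ) (w : Site 4 → Fin 4 → Matrix n n ℂ) : Site 4 → Fin 4 → Matrix n n ℂ :=
  fun z κ => (2 : ℝ)⁻¹ • interp 2 (Finset.univ.erase κ) (stencilInv N (1 / 4 : ℝ) (fun x => w x κ)) z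

/-- **THE ITERATED MAIN PART** over `m` levels (periods `N, 2N, …, 2^m N`). [folklore] -/
def TmatIter (N : ℕ) : ℕ → (Site 4 → Fin 4 → Matrix n n ℂ) → (Site 4 → Fin 4 → Matrix n n ℂ)
  | 0, w => w
  | m + 1, w => Tmat (2 ^ m * N) (TmatIter N m w)

omit [Fintype n] [DecidableEq n] in
/-- Entries of the one-step main part are the scalar one-step main part ✓ `mainC`. [folklore] -/
theorem Tmat_entry (N : ℕ) (w : Site 4 → Fin 4 → Matrix n n ℂ) (z : Site 4) (κ : Fin 4) (i j : n) :
    Tmat N w z κ i j = mainC N κ (fun x => w x κ i j) z := by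
  unfold Tmat mainC
  rw [Matrix.smul_apply, interp_entry]
  congr 2
  funext x
  exact stencilInv_entry N _ _ x i j

omit [Fintype n] [DecidableEq n] in
/-- **ENTRIES OF THE ITERATED MAIN PART ARE THE SCALAR ITERATE ✓ `mainIter`** (values in `ℂ`, a real inner product space). [folklore] -/
theorem TmatIter_entry (N : ℕ) (κ : Fin 4) (i j : n) : ∀ (m : ℕ) (w : Site 4 → Fin 4 → Matrix n n ℂ) (z : Site 4),
    TmatIter N m w z κ i j = mainIter N κ m (fun x => w x κ i j) z := by
  intro m
  induction m with
  | zero => intro w z; rfl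
  | succ m ih =>
      intro w z
      show Tmat (2 ^ m * N) (TmatIter N m w) z κ i j = mainC (2 ^ m * N) κ (mainIter N κ m (fun x => w x κ i j)) z
      rw [Tmat_entry]
      congr 1
      funext x
      exact ih w x

omit [Fintype n] [DecidableEq n] in
/-- The one-step main part of an `N`-periodic 1-form is `2N`-periodic. [folklore] -/
theorem Tmat_periodic (N : ℕ) {w : Site 4 → Fin 4 → Matrix n n ℂ} (hw : ∀ (z : Site 4) (τ κ : Fin 4), w (z + (N : ℤ) • e τ) κ = w z κ)
    (z : Site 4) (τ κ : Fin 4) : Tmat N w (z + ((2 * N : ℕ) : ℤ) • e τ) κ = Tmat N w z κ := by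
  unfold Tmat
  have hφ : ∀ (x : Site 4) (τ' : Fin 4), stencilInv N (1 / 4 : ℝ) (fun x => w x κ) (x + (N : ℤ) • e τ') = stencilInv N (1 / 4 : ℝ) (fun x => w x κ) x :=
    fun x τ' => stencilInv_periodic N _ (fun y => hw y τ' κ) x
  rw [interp_add_period (by norm_num : 1 ≤ 2) (Finset.univ.erase κ) hφ z τ]

omit [Fintype n] [DecidableEq n] in
/-- The iterated main part of an `N`-periodic 1-form is `2^m N`-periodic. [folklore] -/
theorem TmatIter_periodic (N : ℕ) {w : Site 4 → Fin 4 → Matrix n n ℂ} (hw : ∀ (z : Site 4) (τ κ : Fin 4), w (z + (N : ℤ) • e τ) κ = w z κ) :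
    ∀ (m : ℕ) (z : Site 4) (τ κ : Fin 4), TmatIter N m w (z + ((2 ^ m * N : ℕ) : ℤ) • e τ) κ = TmatIter N m w z κ := by
  intro m
  induction m with
  | zero => intro z τ κ; simpa [TmatIter] using hw z τ κ
  | succ m ih =>
      intro z τ κ
      have h := Tmat_periodic (2 ^ m * N) ih z τ κ
      rw [show 2 * (2 ^ m * N) = 2 ^ (m + 1) * N by ring] at h
      exact h

/-! ## §3 The operator-norm bound on the composites of the main part -/

omit [DecidableEq n] in
/-- Reordering a box sum of entry masses. [folklore] -/
theorem sum_entries_comm (g : Site d → Fin d → n → n → ℝ) (F : Finset (Site d)) :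
    ∑ x ∈ F, ∑ κ : Fin d, ∑ i, ∑ j, g x κ i j = ∑ κ : Fin d, ∑ i, ∑ j, ∑ x ∈ F, g x κ i j := by
  rw [Finset.sum_comm]
  refine Finset.sum_congr rfl fun κ _ => ?_
  rw [Finset.sum_comm]
  refine Finset.sum_congr rfl fun i _ => ?_
  rw [Finset.sum_comm]

/-- **HEADLINE — THE COMPOSITES OF THE MAIN PART ON MATRIX 1-FORMS** (`d = 4`, `M = 2`, `N ≥ 1`, `w` `N`-periodic):
`dirSq (TmatIter N m w) [0,2^mN)⁴ ≤ card n · 12⁴ · (3(17∕8)³∕4)^m · dirSq w [0,N)⁴` — uniform in `m` and `N`; `3(17∕8)³∕4 = 7.197 < 8 = L³`. [folklore] -/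
theorem dirSq_TmatIter_le {N : ℕ} (hN : 1 ≤ N) {w : Site 4 → Fin 4 → Matrix n n ℂ} (hw : ∀ (z : Site 4) (τ κ : Fin 4), w (z + (N : ℤ) • e τ) κ = w z κ) (m : ℕ) :
    dirSq (TmatIter N m w) (periodBox (d := 4) (2 ^ m * N)) ≤ (Fintype.card n : ℝ) * (12 : ℝ) ^ 4 * (3 * (17 / 8 : ℝ) ^ 3 / 4) ^ m * dirSq w (periodBox (d := 4) N) := by
  have hent : ∀ (κ : Fin 4) (i j : n), ∑ x ∈ periodBox (d := 4) (2 ^ m * N), ‖TmatIter N m w x κ i j‖ ^ 2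
      ≤ (12 : ℝ) ^ 4 * (3 * (17 / 8 : ℝ) ^ 3 / 4) ^ m * ∑ x ∈ periodBox (d := 4) N, ‖w x κ i j‖ ^ 2 := by
    intro κ i j
    have hu : ∀ (y : Site 4) (τ : Fin 4), w (y + (N : ℤ) • e τ) κ i j = w y κ i j := fun y τ => by rw [hw]
    have h := sum_norm_sq_mainIter_le (X := ℂ) hN κ (u := fun x => w x κ i j) hu m
    simp only [← TmatIter_entry] at h
    exact h
  calc dirSq (TmatIter N m w) (periodBox (d := 4) (2 ^ m * N))
      ≤ ∑ x ∈ periodBox (d := 4) (2 ^ m * N), ∑ κ : Fin 4, ∑ i, ∑ j, ‖TmatIter N m w x κ i j‖ ^ 2 := dirSq_le_sum_entries _ _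
    _ = ∑ κ : Fin 4, ∑ i, ∑ j, ∑ x ∈ periodBox (d := 4) (2 ^ m * N), ‖TmatIter N m w x κ i j‖ ^ 2 := sum_entries_comm _ _
    _ ≤ ∑ κ : Fin 4, ∑ i, ∑ j, (12 : ℝ) ^ 4 * (3 * (17 / 8 : ℝ) ^ 3 / 4) ^ m * ∑ x ∈ periodBox (d := 4) N, ‖w x κ i j‖ ^ 2 :=
        Finset.sum_le_sum fun κ _ => Finset.sum_le_sum fun i _ => Finset.sum_le_sum fun j _ => hent κ i j
    _ = (12 : ℝ) ^ 4 * (3 * (17 / 8 : ℝ) ^ 3 / 4) ^ m * ∑ x ∈ periodBox (d := 4) N, ∑ κ : Fin 4, ∑ i, ∑ j, ‖w x κ i j‖ ^ 2 := by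
        rw [sum_entries_comm, Finset.mul_sum]
        simp only [Finset.mul_sum]
    _ ≤ (12 : ℝ) ^ 4 * (3 * (17 / 8 : ℝ) ^ 3 / 4) ^ m * ((Fintype.card n : ℝ) * dirSq w (periodBox (d := 4) N)) :=
        mul_le_mul_of_nonneg_left (sum_entries_le_card_mul_dirSq _ _) (by positivity)
    _ = (Fintype.card n : ℝ) * (12 : ℝ) ^ 4 * (3 * (17 / 8 : ℝ) ^ 3 / 4) ^ m * dirSq w (periodBox (d := 4) N) := by ring

end

end Summit.QuantumFields.BalabanUV.T4Continuum.NE7LiftMainPartMatrix
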